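import Literature.Algebra.Polynomial.DiscriminantMul
import Mathlib.FieldTheory.Finite.Extension
import Mathlib.FieldTheory.IsAlgClosed.AlgebraicClosure
import Mathlib.NumberTheory.LegendreSymbol.QuadraticChar.Basic
import Mathlib.GroupTheory.Perm.Fin
import Mathlib.Algebra.CharP.Frobenius
import Mathlib.Algebra.CharP.Algebra
import HarnessLib

/-!
# The Stickelberger–Swan parity theorem over a finite field: `r ≡ n (mod 2)` iff `D(g)` is a square (and Dickson's theorem) — Swan, *Factorization of polynomials over finite fields*, Corollary 1

Topic `Literature/FieldTheory/FiniteFields`, namespace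
`Literature.FieldTheory.FiniteFields.StickelbergerSwanTheorem` (lane `lit-semireg`, literature-prover
hsemireg-lit-8 g31).  Everything here is **proved**; theorems only (no `def`, no named fact, no instance,
no notation).  `D(g)` is Mathlib's Sylvester-matrix `Polynomial.discr g`; "`D(g)` is a square in `K`"
is `IsSquare g.discr`, equivalently (for `D ≠ 0`) `quadraticChar K g.discr = 1`; "the number of
irreducible factors of `g`" is `Multiset.card (UniqueFactorizationMonoid.normalizedFactors g)`.

Source, verbatim.  R. G. Swan, *Factorization of polynomials over finite fields*, Pacific J. Math. **12**
(1962), 1099–1106 (held `paper:doi-10-2140-pjm-1962-12-1099`), p. 1101: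

> «COROLLARY 1. Let `K` be a finite field of odd characteristic. Let `g(x)` be a polynomial over `K`
> of degree `n` with no repeated root. Let `r` be the number of irreducible factors of `g(x)` over `K`.
> Then `r ≡ n mod 2` if and only if `D(g)` is a square in `K`.»
> «Proof. We can assume that `g(x)` is monic. Let `F` be a `p`-adic field with residue class field
> `K`. … This follows immediately from Hensel's lemma applied to the polynomial `x² − D(f)`.  A more
> elementary proof of Corollary 1 can be obtained by repeating the proof of Theorem 1 using `K` in
> place of `F`.  If `f(x)` is irreducible over `K`, `r = 1` and so `n` is odd if and only if `D(f)` is a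
> square in `K`. This is the theorem of Dickson mentioned above.» (Dickson: Swan's ref. [1], A. A.
> Albert, *Fundamental Concepts of Higher Algebra*, Ch. V, Th. 38.)

The proof of Theorem 1 (p. 1100–1101), repeated over `K`: «Let `σ` generate the galois group … the
roots of `f_j(x)` are given by `σ^i(β_j)` for `0 ≤ i ≤ n_j − 1` … `D(f) = δ(f)²` where
`δ(f) = ∏ (σ^{i₁}β_{j₁} − σ^{i₂}β_{j₂})` … This shows that `σδ(f) = (−1)^{n−r} δ(f)`. Now `D(f)` is a
square in `F` if and only if `δ(f) ∈ F`, which is the case if and only if `σδ(f) = δ(f)`. Therefore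
`D(f)` is a square in `F` if and only if `n ≡ r mod 2`.»

## The proof typed here

We run Swan's «more elementary proof» with the Frobenius `σ(y) = y^q` (`q = #K`) in an extension `E`
of `K`, one irreducible factor at a time, and assemble with the multiplicativity
`D_{fg} = D_f D_g res(f, g)²` (Bombieri–Gubler B.1.11, tree `DiscriminantMul.discr_mul`) and the
quadratic character `χ` of `K` (Mathlib's `quadraticChar`), instead of ordering all the roots at once
(our deviation; the sign count `Σ_j (n_j − 1) = n − r` is the same).

* § 1 (one irreducible factor `h` of degree `d`, monic, root `x ∈ E`): the roots of `h` are the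
  Frobenius conjugates `x^{q^i}`, `i < d`, pairwise distinct, `x^{q^d} = x`, `h = ∏_{i<d} (X − x^{q^i})`
  (Mathlib's `Irreducible.natDegree_dvd_of_dvd_X_pow_card_pow_sub_X`, `FiniteField.expand_card`);
  `D(h) = det V(x^{q^i})²` (tree `DiscriminantRootProduct.discr_prod_X_sub_C_eq_det_vandermonde_sq`) and
  `σ(det V) = det V^q = det(V with rows cyclically shifted) = sign(n-cycle)·det V = (−1)^{d−1} det V`
  (`iterateFrobenius`, `Matrix.det_permute`, `sign_finRotate`) — «`σδ = (−1)^{n−r}δ`» for `r = 1`.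
* § 2: «`D` is a square in `K` iff `δ ∈ K` iff `σδ = δ`»: the fixed points of `y ↦ y^q` in `E` are the
  image of `K` (`FiniteField.roots_X_pow_card_sub_X`), and `δ ≠ 0`; hence DICKSON'S THEOREM
  `IsSquare D(h) ↔ d odd` for `h` irreducible (char `≠ 2`), i.e. `χ(D(h)) = (−1)^{d−1}`.
* § 3: for `g = u · ∏_{j≤r} h_j` with no repeated root, `χ(D(g)) = ∏ χ(D(h_j)) = (−1)^{Σ(n_j−1)} =
  (−1)^{n−r}`, whence Corollary 1.

## What is typed (all `theorem`s)

* § 1 `eval_map_pow_card`, `isRoot_pow_card_pow`, `pow_card_pow_ne_self`, `pow_card_pow_injective`,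
  `roots_map_eq`, `map_eq_prod_X_sub_C`, `pow_card_pow_natDegree` (Frobenius conjugates of a root of an
  irreducible polynomial over a finite field, in any extension field), `pow_card_eq_self_iff` (fixed
  points of Frobenius), **`det_vandermonde_pow_card`** (`(det V)^q = (−1)^{d−1} det V`),
  `algebraMap_discr_eq_det_sq`;
* § 2 `isSquare_iff_pow_card_eq`, **`isSquare_discr_iff_odd_natDegree`** (Dickson's theorem; monic case
  `…_of_monic`), `discr_ne_zero_of_irreducible`, **`quadraticChar_discr_of_irreducible`**
  (`χ(D(h)) = (−1)^{deg h − 1}`);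
* § 3 **`quadraticChar_discr_multiset_prod`** (`χ(D(∏ s)) = (−1)^{deg − #s}` for a multiset `s` of
  irreducibles with separable product), **`card_normalizedFactors_mod_two_eq_iff`** (COROLLARY 1 as
  printed: `r % 2 = n % 2 ↔ IsSquare D(g)` for `g` with no repeated root, `r` = number of irreducible
  factors), `card_normalizedFactors_mod_two_eq_iff_of_squarefree` (the hypothesis as «no repeated
  root» = squarefree).

Honest scope / deviations.  Swan's Theorem 1 itself (`p`-adic fields, Hensel) and the characteristic-`2`
substitute (Corollary 3, `D(F) mod 8`), the application to `xᵖ − 1` (quadratic reciprocity) and § 5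
(trinomials over `GF(2)`) are NOT typed.  The assembly over the irreducible factors by
`D_{fg} = D_f D_g res²` replaces Swan's single ordering of all roots (same sign count).  DEDUP: the tree's
`Barriers/Parity/FunctionFieldMobiusBiasProofs` proves the special case `K = 𝔽₃`, `h` irreducible,
`deg h ≡ 1 (mod 4)` (and `≡ 0 (mod 4)`) in the form `∏ h′(γᵢ) = ±1` for its own purposes (CCG Theorem 2.3);
this file is the general theorem over any finite field of odd characteristic and does not restate those
lemmas (its § 1 follows their pattern with `3 ↦ q`).  Mathlib has no Stickelberger/Swan/Dickson parity
theorem (`rg "Stickelberger" Mathlib` → nothing relevant).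

## References
* [Swan1962] R. G. Swan, *Factorization of polynomials over finite fields*, Pacific J. Math. 12 (1962),
  1099–1106: Corollary 1 and the remark on Dickson's theorem (p. 1101), proof of Theorem 1
  (pp. 1100–1101).
* [BombieriGubler2006] E. Bombieri, W. Gubler, *Heights in Diophantine Geometry*, CUP 2006, App. B.1.5,
  B.1.11 (via `DiscriminantRootProduct`, `DiscriminantMul`).
* [ConradConradGross2008] B. Conrad, K. Conrad, R. Gross, *Prime specialization in genus 0*, Trans. AMS
  360 (2008), Theorem 2.3 / (2.5) (the character form `μ(h) = (−1)^{deg h} χ(disc h)`).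
-/

open Polynomial

namespace Literature.FieldTheory.FiniteFields.StickelbergerSwanTheorem

/-! ## § 1 Frobenius conjugates of a root of an irreducible polynomial over a finite field -/

section Frobenius

variable {K : Type*} [Field K] [Fintype K] {E : Type*} [Field E] [Algebra K E]

/-- `h(y^q) = h(y)^q` for `h ∈ K[X]`, `q = #K`, and `y` in an extension of `K` (Frobenius fixes the
coefficients). [cite: Swan1962, proof of Theorem 1] -/
theorem eval_map_pow_card (h : K[X]) (y : E) :
    (h.map (algebraMap K E)).eval (y ^ Fintype.card K) =
      ((h.map (algebraMap K E)).eval y) ^ Fintype.card K := by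
  rw [← expand_eval, ← map_expand, FiniteField.expand_card, Polynomial.map_pow, eval_pow]

/-- The Frobenius conjugates `x^{q^i}` of a root `x` of `h ∈ K[X]` are roots of `h`.
[cite: Swan1962, proof of Theorem 1] -/
theorem isRoot_pow_card_pow {h : K[X]} {x : E} (hx : (h.map (algebraMap K E)).IsRoot x) (i : ℕ) :
    (h.map (algebraMap K E)).IsRoot (x ^ Fintype.card K ^ i) := by
  induction i with
  | zero => simpa using hx
  | succ i ih =>
    rw [pow_succ, pow_mul, IsRoot.def, eval_map_pow_card, ih.eq_zero,
      zero_pow Fintype.card_ne_zero]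

/-- A root of an irreducible `h ∈ K[X]` of degree `d` has no Frobenius period `0 < k < d` (its minimal
polynomial `h` would divide `X^{q^k} − X`, forcing `d ∣ k`). [cite: Swan1962, proof of Theorem 1] -/
theorem pow_card_pow_ne_self {h : K[X]} (hirr : Irreducible h) (hmo : h.Monic) {x : E}
    (hx : (h.map (algebraMap K E)).IsRoot x) {k : ℕ} (hk0 : 0 < k) (hkd : k < h.natDegree) :
    x ^ Fintype.card K ^ k ≠ x := by
  intro hxk
  have hmin : h = minpoly K x :=
    minpoly.eq_of_irreducible_of_monic hirr (by rwa [aeval_def, eval₂_eq_eval_map]) hmo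
  have hdvd : h ∣ X ^ Nat.card K ^ k - X := by
    rw [hmin, Nat.card_eq_fintype_card]
    apply minpoly.dvd
    simp [hxk]
  have := Nat.le_of_dvd hk0 (hirr.natDegree_dvd_of_dvd_X_pow_card_pow_sub_X hdvd)
  omega

/-- The conjugates `x^{q^i}`, `i < deg h`, of a root `x` of an irreducible `h` are pairwise distinct
(«the roots of `f_j(x)` are given by `σ^i(β_j)` for `0 ≤ i ≤ n_j − 1`»).
[cite: Swan1962, proof of Theorem 1] -/
theorem pow_card_pow_injective {h : K[X]} (hirr : Irreducible h) (hmo : h.Monic) {x : E}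
    (hx : (h.map (algebraMap K E)).IsRoot x) :
    Function.Injective fun i : Fin h.natDegree => x ^ Fintype.card K ^ (i : ℕ) := by
  have key : ∀ i j : ℕ, i < j → j < h.natDegree →
      x ^ Fintype.card K ^ i ≠ x ^ Fintype.card K ^ j := by
    intro i j hij hjd heq
    apply pow_card_pow_ne_self hirr hmo (isRoot_pow_card_pow hx i) (Nat.sub_pos_of_lt hij)
      (by omega : j - i < h.natDegree)
    rw [← pow_mul, ← pow_add, Nat.add_sub_cancel' hij.le]
    exact heq.symm
  intro i j hij
  rcases lt_trichotomy (i : ℕ) j with h | h | h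
  · exact absurd hij (key i j h j.isLt)
  · exact Fin.ext h
  · exact absurd hij.symm (key j i h i.isLt)

/-- The roots of a monic irreducible `h ∈ K[X]` in an extension containing one root `x` are exactly the
conjugates `x^{q^i}`, `i < deg h`, each with multiplicity one. [cite: Swan1962, proof of Theorem 1] -/
theorem roots_map_eq {h : K[X]} (hirr : Irreducible h) (hmo : h.Monic) {x : E}
    (hx : (h.map (algebraMap K E)).IsRoot x) :
    (h.map (algebraMap K E)).roots =
      (Finset.univ : Finset (Fin h.natDegree)).val.map
        fun i : Fin h.natDegree => x ^ Fintype.card K ^ (i : ℕ) := by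
  change _ = (Finset.univ.map ⟨_, pow_card_pow_injective hirr hmo hx⟩).val
  apply roots_eq_of_natDegree_le_card_of_ne_zero
  · intro y hy
    obtain ⟨i, -, rfl⟩ := Finset.mem_map.mp hy
    exact (isRoot_pow_card_pow hx i).eq_zero
  · simp [natDegree_map]
  · exact (hmo.map _).ne_zero

/-- `h = ∏_{i < deg h} (X − x^{q^i})` over the extension. [cite: Swan1962, proof of Theorem 1] -/
theorem map_eq_prod_X_sub_C {h : K[X]} (hirr : Irreducible h) (hmo : h.Monic) {x : E}
    (hx : (h.map (algebraMap K E)).IsRoot x) :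
    h.map (algebraMap K E) = ∏ i : Fin h.natDegree, (X - C (x ^ Fintype.card K ^ (i : ℕ))) := by
  have hroots := roots_map_eq hirr hmo hx
  have hcard : Multiset.card (h.map (algebraMap K E)).roots =
      (h.map (algebraMap K E)).natDegree := by
    rw [hroots, Multiset.card_map, Finset.card_val, Finset.card_fin, natDegree_map]
  rw [← prod_multiset_X_sub_C_of_monic_of_roots_card_eq (hmo.map _) hcard, hroots,
    Multiset.map_map, Finset.prod_map_val]
  rfl

/-- `x^{q^d} = x` for a root `x` of a monic irreducible `h` of degree `d` (the Frobenius orbit of a root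
is a `d`-cycle). [cite: Swan1962, proof of Theorem 1] -/
theorem pow_card_pow_natDegree {h : K[X]} (hirr : Irreducible h) (hmo : h.Monic) {x : E}
    (hx : (h.map (algebraMap K E)).IsRoot x) : x ^ Fintype.card K ^ h.natDegree = x := by
  have hmem : x ^ Fintype.card K ^ h.natDegree ∈ (h.map (algebraMap K E)).roots :=
    (mem_roots (hmo.map _).ne_zero).mpr (isRoot_pow_card_pow hx _)
  rw [roots_map_eq hirr hmo hx, Multiset.mem_map] at hmem
  obtain ⟨i, -, heq⟩ := hmem
  rcases Nat.eq_zero_or_pos (i : ℕ) with hi0 | hi0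
  · rw [hi0] at heq; simpa using heq.symm
  · exfalso
    apply pow_card_pow_ne_self hirr hmo (isRoot_pow_card_pow hx i) (Nat.sub_pos_of_lt i.isLt)
      (Nat.sub_lt (by omega) hi0)
    rw [← pow_mul, ← pow_add, Nat.add_sub_cancel' i.isLt.le]
    exact heq.symm

/-- **The fixed points of the Frobenius `y ↦ y^q` in an extension of `K` are the elements of `K`**
(«`δ(f) ∈ F` … if and only if `σδ(f) = δ(f)`»): they are roots of `X^q − X`, which has its `q` roots
in `K`. [cite: Swan1962, proof of Theorem 1] -/
theorem pow_card_eq_self_iff (y : E) :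
    y ^ Fintype.card K = y ↔ y ∈ Set.range (algebraMap K E) := by
  constructor
  · intro hy
    have hne : (X ^ Fintype.card K - X : K[X]) ≠ 0 :=
      FiniteField.X_pow_card_sub_X_ne_zero K Fintype.one_lt_card
    have hcard : Multiset.card (X ^ Fintype.card K - X : K[X]).roots =
        (X ^ Fintype.card K - X : K[X]).natDegree := by
      rw [FiniteField.roots_X_pow_card_sub_X,
        FiniteField.X_pow_card_sub_X_natDegree_eq K Fintype.one_lt_card]
      rfl
    have hmem : y ∈ ((X ^ Fintype.card K - X : K[X]).map (algebraMap K E)).roots := by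
      rw [mem_roots ((Polynomial.map_ne_zero_iff (algebraMap K E).injective).2 hne)]
      simp [hy]
    rw [← roots_map_of_injective_of_card_eq_natDegree (algebraMap K E).injective hcard,
      Multiset.mem_map] at hmem
    obtain ⟨c, -, rfl⟩ := hmem
    exact ⟨c, rfl⟩
  · rintro ⟨c, rfl⟩
    rw [← map_pow, FiniteField.pow_card]

/-- The value of the cyclic shift `finRotate d` on `Fin d`, for every `d`. [folklore] -/
private theorem finRotate_val (d : ℕ) (i : Fin d) :
    ((finRotate d i : Fin d) : ℕ) = if (i : ℕ) = d - 1 then 0 else (i : ℕ) + 1 := by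
  cases d with
  | zero => exact i.elim0
  | succ k =>
    rw [coe_finRotate]
    simp [Fin.ext_iff]

/-- **Frobenius acts on `δ = det V(x^{q^i})` by the sign of a `d`-cycle:** `δ^q = (−1)^{d−1} δ`
(«`σδ(f) = (−1)^{n−r} δ(f)`» for one irreducible factor, `r = 1`): applying `y ↦ y^q` to the
Vandermonde matrix of the conjugates shifts its rows cyclically (`x^{q^d} = x`).
[cite: Swan1962, proof of Theorem 1] -/
theorem det_vandermonde_pow_card {h : K[X]} (hirr : Irreducible h) (hmo : h.Monic) {x : E}
    (hx : (h.map (algebraMap K E)).IsRoot x) :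
    (Matrix.vandermonde fun i : Fin h.natDegree => x ^ Fintype.card K ^ (i : ℕ)).det ^
        Fintype.card K =
      (-1) ^ (h.natDegree - 1) *
        (Matrix.vandermonde fun i : Fin h.natDegree => x ^ Fintype.card K ^ (i : ℕ)).det := by
  obtain ⟨p, hchar⟩ := CharP.exists K
  obtain ⟨n, hp, hq⟩ := FiniteField.card K p
  haveI : CharP E p := charP_of_injective_algebraMap (algebraMap K E).injective p
  haveI : ExpChar E p := ExpChar.prime hp
  have hd : 0 < h.natDegree := hirr.natDegree_pos
  set d := h.natDegree with hd_def
  set v : Fin d → E := fun i => x ^ Fintype.card K ^ (i : ℕ) with hv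
  set V := Matrix.vandermonde v with hV
  have hperiod : x ^ Fintype.card K ^ d = x := pow_card_pow_natDegree hirr hmo hx
  have e1 : V.det ^ Fintype.card K = ((iterateFrobenius E p n).mapMatrix V).det := by
    rw [← RingHom.map_det, iterateFrobenius_def, hq]
  have e2 : (iterateFrobenius E p n).mapMatrix V = V.submatrix (finRotate d) id := by
    ext i j
    simp only [hV, RingHom.mapMatrix_apply, Matrix.map_apply, Matrix.vandermonde_apply,
      iterateFrobenius_def, Matrix.submatrix_apply, id]
    rw [← hq, ← pow_mul, mul_comm, pow_mul]
    congr 1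
    simp only [hv]
    rw [finRotate_val]
    split_ifs with hi
    · rw [← pow_mul, ← pow_succ, hi, Nat.sub_add_cancel hd, hperiod, pow_zero, pow_one]
    · rw [← pow_mul, ← pow_succ]
  rw [e1, e2, Matrix.det_permute, sign_finRotate, Units.val_pow_eq_pow_val, Units.val_neg,
    Units.val_one, Int.cast_pow, Int.cast_neg, Int.cast_one]

/-- **`D(h) = δ²`** with `δ = det V(x^{q^i})` the Vandermonde determinant of the conjugates
(«`D(f) = δ(f)²`»; B.1.5). [cite: Swan1962, proof of Theorem 1]
[cite: BombieriGubler2006, Appendix B, Remark B.1.5] -/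
theorem algebraMap_discr_eq_det_sq {h : K[X]} (hirr : Irreducible h) (hmo : h.Monic) {x : E}
    (hx : (h.map (algebraMap K E)).IsRoot x) :
    algebraMap K E h.discr =
      (Matrix.vandermonde fun i : Fin h.natDegree => x ^ Fintype.card K ^ (i : ℕ)).det ^ 2 := by
  rw [← Literature.Algebra.Polynomial.DiscriminantRootProduct.discr_map_of_injective _
    (algebraMap K E).injective, map_eq_prod_X_sub_C hirr hmo hx,
    Literature.Algebra.Polynomial.DiscriminantRootProduct.discr_prod_X_sub_C_eq_det_vandermonde_sq]

end Frobenius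

/-! ## § 2 Dickson's theorem: `D(h)` is a square iff `deg h` is odd (`h` irreducible, odd characteristic) -/

section Dickson

variable {K : Type*} [Field K] [Fintype K]

/-- **«`D(f)` is a square in `F` if and only if `δ(f) ∈ F`, which is the case if and only if
`σδ(f) = δ(f)`»**: for `D ∈ K` with `D = δ²` in an extension `E` and `q` odd, `D` is a square in `K`
iff `δ^q = δ`. [cite: Swan1962, proof of Theorem 1] -/
theorem isSquare_iff_pow_card_eq {E : Type*} [Field E] [Algebra K E] {D : K} {δ : E}
    (hD : algebraMap K E D = δ ^ 2) (hodd : Odd (Fintype.card K)) :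
    IsSquare D ↔ δ ^ Fintype.card K = δ := by
  constructor
  · rintro ⟨c, rfl⟩
    have h2 : (algebraMap K E c - δ) * (algebraMap K E c + δ) = 0 := by
      rw [map_mul] at hD; linear_combination hD
    rcases mul_eq_zero.mp h2 with h0 | h0
    · rw [← sub_eq_zero.mp h0, ← map_pow, FiniteField.pow_card]
    · rw [eq_neg_of_add_eq_zero_right h0, neg_pow, hodd.neg_one_pow, ← map_pow,
        FiniteField.pow_card, neg_one_mul]
  · intro hδ
    obtain ⟨c, hc⟩ := (pow_card_eq_self_iff δ).mp hδ
    refine ⟨c, (algebraMap K E).injective ?_⟩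
    rw [hD, ← hc, map_mul, pow_two]

/-- **Dickson's theorem, monic case:** for `h ∈ K[X]` monic irreducible over a finite field of odd
characteristic, `D(h)` is a square in `K` iff `deg h` is odd («if `f(x)` is irreducible over `K`, `r = 1`
and so `n` is odd if and only if `D(f)` is a square in `K`. This is the theorem of Dickson»).
[cite: Swan1962, Corollary 1 and the remark following it, p. 1101] -/
theorem isSquare_discr_iff_odd_natDegree_of_monic (hK : ringChar K ≠ 2) {h : K[X]}
    (hirr : Irreducible h) (hmo : h.Monic) : IsSquare h.discr ↔ Odd h.natDegree := by
  let E := AlgebraicClosure K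
  obtain ⟨x, hx⟩ : ∃ x : E, (h.map (algebraMap K E)).IsRoot x :=
    IsAlgClosed.exists_root _ (by
      rw [degree_map, degree_eq_natDegree hirr.ne_zero]
      exact_mod_cast hirr.natDegree_pos.ne')
  have hodd : Odd (Fintype.card K) := Nat.odd_iff.2 (FiniteField.odd_card_of_char_ne_two hK)
  set V := Matrix.vandermonde fun i : Fin h.natDegree => x ^ Fintype.card K ^ (i : ℕ) with hV
  have hVne : V.det ≠ 0 :=
    Matrix.det_vandermonde_ne_zero_iff.mpr (pow_card_pow_injective hirr hmo hx)
  rw [isSquare_iff_pow_card_eq (algebraMap_discr_eq_det_sq hirr hmo hx) hodd,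
    det_vandermonde_pow_card hirr hmo hx]
  have h2 : (-1 : E) ≠ 1 := by
    haveI := ringChar.charP K
    haveI : CharP E (ringChar K) :=
      charP_of_injective_algebraMap (algebraMap K E).injective (ringChar K)
    exact Ring.neg_one_ne_one_of_char_ne_two (by rwa [ringChar.eq E (ringChar K)])
  constructor
  · intro h1
    have : ((-1 : E) ^ (h.natDegree - 1) - 1) * V.det = 0 := by linear_combination h1
    rcases mul_eq_zero.mp this with h0 | h0
    · have hev : Even (h.natDegree - 1) := by
        by_contra hne
        rw [Nat.not_even_iff_odd] at hne
        rw [hne.neg_one_pow, sub_eq_zero] at h0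
        exact h2 h0
      have := hirr.natDegree_pos
      obtain ⟨t, ht⟩ := hev
      exact ⟨t, by omega⟩
    · exact absurd h0 hVne
  · intro hodd'
    have hev : Even (h.natDegree - 1) := by obtain ⟨t, ht⟩ := hodd'; exact ⟨t, by omega⟩
    rw [hev.neg_one_pow, one_mul]

omit [Fintype K] in
/-- A nonzero square factor does not change squareness. [folklore] -/
private theorem isSquare_mul_sq_iff {a b : K} (ha : a ≠ 0) : IsSquare (a ^ 2 * b) ↔ IsSquare b := by
  constructor
  · rintro ⟨c, hc⟩
    exact ⟨c / a, by field_simp; linear_combination hc⟩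
  · rintro ⟨c, rfl⟩
    exact ⟨a * c, by ring⟩

/-- The discriminant of an irreducible polynomial over a finite field is nonzero (its roots, the
Frobenius conjugates, are pairwise distinct). [cite: Swan1962, proof of Theorem 1] -/
theorem discr_ne_zero_of_irreducible {h : K[X]} (hirr : Irreducible h) : h.discr ≠ 0 := by
  set c := h.leadingCoeff with hc
  have hc0 : c ≠ 0 := leadingCoeff_ne_zero.mpr hirr.ne_zero
  set h₀ := C c⁻¹ * h with hh₀
  have hmo : h₀.Monic := by
    rw [hh₀, Monic, leadingCoeff_mul, leadingCoeff_C, ← hc, inv_mul_cancel₀ hc0]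
  have hirr₀ : Irreducible h₀ := by
    rw [hh₀]
    exact (irreducible_isUnit_mul (isUnit_C.mpr (IsUnit.mk0 _ (inv_ne_zero hc0)))).mpr hirr
  have hh : h = C c * h₀ := by
    rw [hh₀, ← mul_assoc, ← C_mul, mul_inv_cancel₀ hc0, C_1, one_mul]
  have hdeg : 0 < h₀.degree := by
    rw [degree_eq_natDegree hirr₀.ne_zero]; exact_mod_cast hirr₀.natDegree_pos
  rw [hh, Literature.Algebra.Polynomial.DiscriminantRootProduct.discr_C_mul hc0 hdeg]
  refine mul_ne_zero (pow_ne_zero _ hc0) ?_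
  let E := AlgebraicClosure K
  obtain ⟨x, hx⟩ : ∃ x : E, (h₀.map (algebraMap K E)).IsRoot x :=
    IsAlgClosed.exists_root _ (by
      rw [degree_map, degree_eq_natDegree hirr₀.ne_zero]
      exact_mod_cast hirr₀.natDegree_pos.ne')
  intro h0
  have := algebraMap_discr_eq_det_sq hirr₀ hmo hx
  rw [h0, map_zero, eq_comm, sq_eq_zero_iff] at this
  exact Matrix.det_vandermonde_ne_zero_iff.mpr (pow_card_pow_injective hirr₀ hmo hx) this

/-- **Dickson's theorem:** for `h ∈ K[X]` irreducible over a finite field `K` of odd characteristic,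
`D(h)` is a square in `K` if and only if `deg h` is odd. [cite: Swan1962, Corollary 1 and the remark
following it, p. 1101] -/
theorem isSquare_discr_iff_odd_natDegree (hK : ringChar K ≠ 2) {h : K[X]} (hirr : Irreducible h) :
    IsSquare h.discr ↔ Odd h.natDegree := by
  set c := h.leadingCoeff with hc
  have hc0 : c ≠ 0 := leadingCoeff_ne_zero.mpr hirr.ne_zero
  set h₀ := C c⁻¹ * h with hh₀
  have hmo : h₀.Monic := by
    rw [hh₀, Monic, leadingCoeff_mul, leadingCoeff_C, ← hc, inv_mul_cancel₀ hc0]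
  have hirr₀ : Irreducible h₀ := by
    rw [hh₀]
    exact (irreducible_isUnit_mul (isUnit_C.mpr (IsUnit.mk0 _ (inv_ne_zero hc0)))).mpr hirr
  have hh : h = C c * h₀ := by
    rw [hh₀, ← mul_assoc, ← C_mul, mul_inv_cancel₀ hc0, C_1, one_mul]
  have hdeg : 0 < h₀.degree := by
    rw [degree_eq_natDegree hirr₀.ne_zero]; exact_mod_cast hirr₀.natDegree_pos
  rw [hh, Literature.Algebra.Polynomial.DiscriminantRootProduct.discr_C_mul hc0 hdeg,
    show c ^ (2 * h₀.natDegree - 2) = (c ^ (h₀.natDegree - 1)) ^ 2 by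
      rw [← pow_mul]; congr 1; omega,
    isSquare_mul_sq_iff (pow_ne_zero _ hc0), isSquare_discr_iff_odd_natDegree_of_monic hK hirr₀ hmo,
    natDegree_C_mul hc0]

/-- **Dickson's theorem in character form:** `χ(D(h)) = (−1)^{deg h − 1}` for the quadratic character
`χ` of `K` and `h` irreducible (the factor `(−1)^{n_j − 1}` of one `n_j`-cycle in «`σδ = (−1)^{n−r}δ`»).
[cite: Swan1962, Corollary 1 and proof of Theorem 1] -/
theorem quadraticChar_discr_of_irreducible [DecidableEq K] (hK : ringChar K ≠ 2) {h : K[X]}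
    (hirr : Irreducible h) : quadraticChar K h.discr = (-1) ^ (h.natDegree - 1) := by
  have hne := discr_ne_zero_of_irreducible (K := K) hirr
  rcases Nat.even_or_odd h.natDegree with hev | hodd
  · have hodd' : Odd (h.natDegree - 1) := by
      have := hirr.natDegree_pos
      obtain ⟨t, ht⟩ := hev
      exact ⟨t - 1, by omega⟩
    rw [hodd'.neg_one_pow, quadraticChar_neg_one_iff_not_isSquare,
      isSquare_discr_iff_odd_natDegree hK hirr]
    exact Nat.not_odd_iff_even.mpr hev
  · have hev' : Even (h.natDegree - 1) := by obtain ⟨t, ht⟩ := hodd; exact ⟨t, by omega⟩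
    rw [hev'.neg_one_pow, quadraticChar_one_iff_isSquare hne,
      isSquare_discr_iff_odd_natDegree hK hirr]
    exact hodd

end Dickson

/-! ## § 3 Stickelberger–Swan parity: `r ≡ n (mod 2)` iff `D(g)` is a square -/

section Stickelberger

variable {K : Type*} [Field K] [Fintype K]

omit [Fintype K] in
/-- A product of `r` irreducible polynomials has degree `≥ r` (and is nonzero). [folklore] -/
private theorem card_le_natDegree_prod {s : Multiset K[X]} (hs : ∀ p ∈ s, Irreducible p) :
    Multiset.card s ≤ s.prod.natDegree ∧ s.prod ≠ 0 := by
  induction s using Multiset.induction_on with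
  | empty => simp
  | cons p t ih =>
    obtain ⟨hle, hne⟩ := ih fun q hq => hs q (Multiset.mem_cons_of_mem hq)
    have hp := hs p (Multiset.mem_cons_self p t)
    refine ⟨?_, ?_⟩
    · rw [Multiset.prod_cons, natDegree_mul hp.ne_zero hne, Multiset.card_cons]
      have := hp.natDegree_pos
      omega
    · rw [Multiset.prod_cons]; exact mul_ne_zero hp.ne_zero hne

/-- **The parity theorem in character form** («`σδ(f) = (−1)^{n−r} δ(f)`»): if `g = ∏ s` is a product of
`r = #s` irreducible polynomials with no repeated root (i.e. `g` separable) over a finite field of odd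
characteristic, of degree `n`, then `χ(D(g)) = (−1)^{n−r}` — by Dickson's theorem on each factor and
`D_{fg} = D_f D_g res(f, g)²`. [cite: Swan1962, Corollary 1, p. 1101]
[cite: BombieriGubler2006, Appendix B, B.1.11] -/
theorem quadraticChar_discr_multiset_prod [DecidableEq K] (hK : ringChar K ≠ 2) {s : Multiset K[X]}
    (hs : ∀ p ∈ s, Irreducible p) (hsep : s.prod.Separable) :
    quadraticChar K s.prod.discr = (-1) ^ (s.prod.natDegree - Multiset.card s) := by
  induction s using Multiset.induction_on with
  | empty =>
    rw [Multiset.prod_zero, ← C_1, discr_C, map_one, Multiset.card_zero, natDegree_C, pow_zero]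
  | cons p t ih =>
    have hp := hs p (Multiset.mem_cons_self p t)
    have ht : ∀ q ∈ t, Irreducible q := fun q hq => hs q (Multiset.mem_cons_of_mem hq)
    rw [Multiset.prod_cons] at hsep ⊢
    rw [Multiset.card_cons]
    obtain ⟨hle, hne⟩ := card_le_natDegree_prod ht
    rcases eq_or_ne t 0 with rfl | ht0
    · rw [Multiset.prod_zero, mul_one, quadraticChar_discr_of_irreducible hK hp, Multiset.card_zero]
    · have hdp : 0 < p.degree := by
        rw [degree_eq_natDegree hp.ne_zero]; exact_mod_cast hp.natDegree_pos
      have hdt : 0 < t.prod.degree := by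
        rw [degree_eq_natDegree hne]
        have : 0 < Multiset.card t := Multiset.card_pos.mpr ht0
        exact_mod_cast (show 0 < t.prod.natDegree by omega)
      rw [Literature.Algebra.Polynomial.DiscriminantMul.discr_mul hdp hdt, map_mul, map_mul,
        quadraticChar_sq_one' (resultant_ne_zero _ _ hsep.isCoprime), mul_one,
        quadraticChar_discr_of_irreducible hK hp, ih ht hsep.of_mul_right,
        natDegree_mul hp.ne_zero hne, ← pow_add]
      have := hp.natDegree_pos
      congr 1
      omega

/-- **Swan's Corollary 1 (Stickelberger's theorem over a finite field).** «Let `K` be a finite field of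
odd characteristic. Let `g(x)` be a polynomial over `K` of degree `n` with no repeated root. Let `r` be
the number of irreducible factors of `g(x)` over `K`. Then `r ≡ n mod 2` if and only if `D(g)` is a
square in `K`.»  Here "no repeated root" is `g.Separable`, `r = #(normalizedFactors g)` and `D(g)` is
Mathlib's `Polynomial.discr g`. [cite: Swan1962, Corollary 1, p. 1101] -/
theorem card_normalizedFactors_mod_two_eq_iff [DecidableEq K] (hK : ringChar K ≠ 2) {g : K[X]}
    (hsep : g.Separable) :
    Multiset.card (UniqueFactorizationMonoid.normalizedFactors g) % 2 = g.natDegree % 2 ↔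
      IsSquare g.discr := by
  have hg0 : g ≠ 0 := hsep.ne_zero
  set s := UniqueFactorizationMonoid.normalizedFactors g with hs_def
  have hs : ∀ p ∈ s, Irreducible p := fun p hp =>
    UniqueFactorizationMonoid.irreducible_of_normalized_factor p hp
  obtain ⟨u, hu⟩ := UniqueFactorizationMonoid.prod_normalizedFactors hg0
  rw [← hs_def] at hu
  obtain ⟨c, hc, hcu⟩ := Polynomial.isUnit_iff.mp u.isUnit
  have hc0 : c ≠ 0 := hc.ne_zero
  have hg : g = C c * s.prod := by rw [← hu, ← hcu, mul_comm]
  obtain ⟨hle, hne⟩ := card_le_natDegree_prod hs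
  have hnat : g.natDegree = s.prod.natDegree := by rw [hg, natDegree_C_mul hc0]
  have hsep' : s.prod.Separable := by rw [hg] at hsep; exact hsep.of_mul_right
  have hchar := quadraticChar_discr_multiset_prod hK hs hsep'
  -- `D(g)` and `D(∏ s)` differ by the square `c^{2n−2}`
  have hsq : IsSquare g.discr ↔ IsSquare s.prod.discr := by
    rcases Nat.eq_zero_or_pos s.prod.natDegree with h0 | hpos
    · have hs0 : s = 0 := by
        by_contra hne0
        have := Multiset.card_pos.mpr hne0
        omega
      rw [hg, hs0, Multiset.prod_zero, mul_one, ← C_1, discr_C, discr_C]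
    · rw [hg, Literature.Algebra.Polynomial.DiscriminantRootProduct.discr_C_mul hc0
        (by rw [degree_eq_natDegree hne]; exact_mod_cast hpos),
        show c ^ (2 * s.prod.natDegree - 2) = (c ^ (s.prod.natDegree - 1)) ^ 2 by
          rw [← pow_mul]; congr 1; omega,
        isSquare_mul_sq_iff (pow_ne_zero _ hc0)]
  have hD0 : s.prod.discr ≠ 0 := by
    intro h0
    rw [h0, MulChar.map_zero] at hchar
    exact (pow_ne_zero _ (by norm_num : (-1 : ℤ) ≠ 0)) hchar.symm
  rw [hsq, ← quadraticChar_one_iff_isSquare hD0, hchar, hnat,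
    neg_one_pow_eq_one_iff_even (by norm_num)]
  constructor
  · intro h; exact ⟨(s.prod.natDegree - Multiset.card s) / 2, by omega⟩
  · rintro ⟨t, ht⟩; omega

/-- Corollary 1 with «no repeated root» read as *squarefree* (equivalent to separable over the perfect
field `K`). [cite: Swan1962, Corollary 1, p. 1101] -/
theorem card_normalizedFactors_mod_two_eq_iff_of_squarefree [DecidableEq K] (hK : ringChar K ≠ 2)
    {g : K[X]} (hsq : Squarefree g) :
    Multiset.card (UniqueFactorizationMonoid.normalizedFactors g) % 2 = g.natDegree % 2 ↔
      IsSquare g.discr :=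
  card_normalizedFactors_mod_two_eq_iff hK (PerfectField.separable_iff_squarefree.mpr hsq)

end Stickelberger

end Literature.FieldTheory.FiniteFields.StickelbergerSwanTheorem
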